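import Summits.AtomisticToContinuum.Crystallization.Theorems.ExcessDecayLiouvilleChainRun

/-!
# Route `ExcessDecayLiouville`: phase one — the single step at the centre of the ball (nonlinear half, XLII)

Harmonic-replacement architecture for item `ExcessDecay` (stmt-AtomisticToContinuum-9334), nonlinear half.
`phase_one`: one `scale_step` about the centre `c` of `B_r(c)` at the top scale `ρ⋆ = σ⋆² = (r − 153600)/737600`,
started from the relaxed datum `𝟙_{S₀}ξ₀` (`base_relaxation`), whose cut-off displacement is pointwise `≤ ε'`
(so its masses are `≤ 32 Y³ ε'² ≤ 32 γ⋆² Y⁶` for `Y ≥ σ⋆²`, `γ⋆σ⋆³ = ε'`).  The output is the common affine-plus-shift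
approximant `aff⋆` of phase two together with its data about `c`, the increments in the root variables, and the raw
mass bounds of its cut-off displacement about `c` on the fresh range `[1, σ⋆²]` (envelope) and the propagated range
`[σ⋆², ∞)` (triangle inequality).
All `[folklore]`; helper lemmas, nothing here closes an item.
-/

noncomputable section

namespace Summit.AtomisticToContinuum.Crystallization.Theorems.ExcessDecayLiouville

open scoped BigOperators Topology InnerProductSpace RealInnerProductSpace Classical
open Literature.MathematicalPhysics.StatisticalMechanics
open Summit.AtomisticToContinuum.Crystallization.Theorems.PhononStabilityNegative

local notation "E3" => EuclideanSpace ℝ (Fin 3)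

-- Local notation: the force-constant map `K(e)w = h(|e|²)w + 2⟪e,w⟫h′(|e|²)e`.
local notation3 "𝕂[" e "] " w:max =>
  (-((‖e‖ ^ 2)⁻¹) ^ 7 + ((‖e‖ ^ 2)⁻¹) ^ 4) • w + (2 * ⟪e, w⟫ * (7 * ((‖e‖ ^ 2)⁻¹) ^ 8 - 4 * ((‖e‖ ^ 2)⁻¹) ^ 5)) • e
-- Local notation: the pair force `F(x) = h(|x|²) x`.
local notation3 "𝐅[" x "]" => ((-((‖x‖ ^ 2)⁻¹) ^ 7 + ((‖x‖ ^ 2)⁻¹) ^ 4) • x)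
set_option quotPrecheck false in
-- Local notation: ball indicator.
local notation "𝟙ᵇ[" x ", " c ", " R "]" => (if dist (x : EuclideanSpace ℝ (Fin 3)) c ≤ R then (1 : ℝ) else 0)

section

variable {X : Set E3} {c : E3} {r ε δ κ : ℝ} {t : Fin 2 → E3} {A : E3 →L[ℝ] E3} {π : E3 → E3}
  {aff₀ aff : E3 → E3} {a : Fin 2 → E3} {B : E3 →L[ℝ] E3} {c₀ : E3}

variable (hA : Adm₀ A) (hI : Inner₀ t A)

set_option quotPrecheck false in
-- Local notation: the operator row `(L v)(p)`.
local notation "𝕃" v:max " @ " p:max =>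
  tsum (fun q : Sites₀ t A => (if ((p : Sites₀ t A) : E3) ≠ q then 𝕂[((p : Sites₀ t A) : E3) - q] (v ((p : Sites₀ t A) : E3) - v q) else 0))
set_option quotPrecheck false in
-- Local notation: the finite near-neighbour form on the ball of radius `X` about `c₀`.
local notation "NN[" v ", " X "]" =>
  (∑ p ∈ (finite_sites_dist_le (t := t) (A := A) hA hI c₀ X).toFinset,
    ∑ q ∈ (finite_sites_dist_le (t := t) (A := A) hA hI c₀ X).toFinset,
      (if p ≠ q ∧ dist p q ≤ 11 / 10 then ‖v p - v q‖ ^ 2 else (0 : ℝ)))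
set_option quotPrecheck false in
-- local mass on the ball of radius `X` about `c₀`
local notation "𝐌[" f ", " X "]" =>
  tsum (fun p : Sites₀ t A => ‖f (p : E3)‖ ^ 2 * 𝟙ᵇ[p, c₀, X])
set_option quotPrecheck false in
-- Local notation: the displaced self-force `G(p)` of the background `aff`.
local notation "𝐆[" aff "] " p:max =>
  tsum (fun q : Sites₀ t A => (if (p : E3) ≠ q then 𝐅[((p : E3) - q) + (aff (p : E3) - aff q)] else 0))
set_option quotPrecheck false in
-- Local notation: the radial site cut-off `= 1` on the sites of `B_{r₁}(c)`, `0` beyond `r₁ + w`, slope `1/w`.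
local notation "𝛘[" r₁ ", " w "]" =>
  (fun x : EuclideanSpace ℝ (Fin 3) => (if x ∈ Sites₀ t A then max (min 1 ((r₁ + w - dist x c) / w)) 0 else 0))

-- one `scale_step` plus the bookkeeping of its outputs; ~6·10⁵ heartbeats
set_option maxHeartbeats 800000 in
include hA hI in
/-- **Phase one** (see the module docstring). [folklore] -/
theorem phase_one (hκ0 : 0 < κ) (hκ1 : κ ≤ 1)
    (hκ : ∀ v : E3 → E3, (Function.support v).Finite →
      Function.support v ⊆ Sites₀ t A → κ * nnForm t A v ≤ ∑' p : Sites₀ t A, ⟪𝕃 v @ p, v p⟫)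
    (hX : X.Finite) (hsep : Sep₀ X δ) (hequil : Equil₀ X) (hδ : 0 < δ) (hδ1 : δ ≤ 1)
    (hε0 : 0 ≤ ε) (hε : 2 * ε < δ) (hr : 192 ≤ r)
    (hXb : ∀ p ∈ X, dist p c ≤ r → ∃ m : Fin 2, ∃ z ∈ Λ₀, dist p (t m + A z) ≤ ε)
    (hπ : ∀ s' ∈ Sites₀ t A, dist s' c ≤ r → π s' ∈ X ∧ dist (π s') s' ≤ ε)
    (hinj : ∀ s₁ ∈ Sites₀ t A, ∀ s₂ ∈ Sites₀ t A, dist s₁ c ≤ r → dist s₂ c ≤ r → π s₁ = π s₂ → s₁ = s₂)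
    (SR : Finset E3) (hSR : ∀ x, x ∈ SR ↔ x ∈ Sites₀ t A ∧ dist x c ≤ r)
    -- the relaxed datum
    (ξ₀ : E3)
    (haff₀ : ∀ (m : Fin 2) (z : E3), z ∈ Λ₀ →
      (fun x : E3 => (0 : E3) + (if (∃ z ∈ Λ₀, x = t 0 + A z) then ξ₀ else 0)) (t m + A z) =
        (![(0 : E3) + ξ₀, 0] : Fin 2 → E3) m + (0 : E3 →L[ℝ] E3) (t m + A z - c))
    (hrel₀ : ∀ p : Sites₀ t A, 𝐆[fun x : E3 => (0 : E3) + (if (∃ z ∈ Λ₀, x = t 0 + A z) then ξ₀ else 0)] p = 0)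
    {εp : ℝ} (hεp0 : 0 ≤ εp)
    (hεp : ∀ x ∈ SR, ‖(π x - x) - (fun x : E3 => (0 : E3) + (if (∃ z ∈ Λ₀, x = t 0 + A z) then ξ₀ else 0)) x‖ ≤ εp)
    -- the scale and the numerical inputs
    {σs γs Du ν : ℝ} (hσs : 737600 * σs ^ 2 + 153600 = r) (hσ8 : 8 ≤ σs) (hγs0 : 0 ≤ γs) (hγs : γs * σs ^ 3 = εp)
    (hDu0 : 0 ≤ Du) (hDu1 : Du ≤ 1 / 20) (hεpDu : εp ≤ Du) (hν : 0 ≤ ν)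
    {ja jb : ℝ} (hN : ntotGen κ r δ ε Du ja jb ≤ ν ^ 2 * r ^ 7) (hξja : ‖ξ₀‖ ≤ ja) (hja : ja ≤ 1 / 100) (hjb : 0 ≤ jb)
    (CΛ : 4000000 * (210000 * ((25 / 23) * (2 * Du + ja) + jb)) ≤ κ / 12)
    (hξκ : ‖ξ₀‖ ≤ κ / (2 * 10 ^ 10))
    (hΛκ : 4000000 * lamOf Du ‖ξ₀‖ 0 ≤ κ / 16)
    (hsmall : lcOf κ ^ 13 * sAgg σs γs (phiOf Du r δ) Du r ν ≤ κ ^ 2 / 10 ^ 11) :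
    ∃ (aff' : E3 → E3) (a' : Fin 2 → E3) (B' : E3 →L[ℝ] E3) (K s W Va bT : ℝ),
      (∀ (m : Fin 2) (z : E3), z ∈ Λ₀ → aff' (t m + A z) = a' m + B' (t m + A z - c)) ∧
      (∀ p : Sites₀ t A, 𝐆[aff'] p = 0) ∧
      0 ≤ K ∧ K ≤ 1428 * lcOf κ ^ 9 * (γs / σs + phiOf Du r δ + Du / (σs ^ 2 * r ^ 2) + σs ^ 2 * ν) ∧
      0 ≤ s ∧ s ≤ lcOf κ ^ 13 * sAgg σs γs (phiOf Du r δ) Du r ν ∧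
      0 ≤ W ∧ W ≤ lcOf κ ^ 12 * (γs + lamOf Du ‖ξ₀‖ 0 * γs * σs ^ 6 + σs ^ 7 * phiOf Du r δ + σs ^ 4 * Du / r ^ 2) ^ 2 ∧
      0 ≤ Va ∧ Va ≤ lcOf κ ^ 8 * vAgg σs γs (phiOf Du r δ) Du r + (66 / 5) * lcOf κ ^ 8 * sAgg σs γs (phiOf Du r δ) Du r ν ∧
      0 ≤ bT ∧ bT ≤ 12 * lcOf κ ^ 8 * sAgg σs γs (phiOf Du r δ) Du r ν ∧
      (∀ Y : ℝ, 1 ≤ Y → Y ≤ σs ^ 2 →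
        (∑' p : Sites₀ t A, ‖(fun x : E3 => 𝛘[r / 2, r / 4] x • ((π x - x) - aff' x)) (p : E3)‖ ^ 2 * 𝟙ᵇ[p, c, Y]) ≤
          2 * (32 * Y ^ 3 * (3 * (K * (Y + 11 / 10) ^ 2) ^ 2 + 3 * s ^ 2)) + 2 * W) ∧
      (∀ Y : ℝ, 1 ≤ Y → σs ^ 2 ≤ Y →
        (∑' p : Sites₀ t A, ‖(fun x : E3 => 𝛘[r / 2, r / 4] x • ((π x - x) - aff' x)) (p : E3)‖ ^ 2 * 𝟙ᵇ[p, c, Y]) ≤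
          2 * (32 * Y ^ 3 * εp ^ 2) + 2 * (32 * Y ^ 3 * (Va + s + bT * (Y + 11 / 10)) ^ 2)) ∧
      ‖B'‖ ≤ bT ∧ ‖a' 0 - a' 1‖ ≤ ‖ξ₀‖ + 2 * lcOf κ ^ 13 * sAgg σs γs (phiOf Du r δ) Du r ν ∧
      (∀ m, ‖a' m‖ ≤ ‖ξ₀‖ + Va + bT * (11 / 10) + s) ∧
      (∀ x ∈ SR, ‖(π x - x) - aff' x‖ ≤ εp + Va + bT * (r + 11 / 10) + s) := by
  obtain ⟨hL, -, -⟩ := lcOf_ge hκ0 hκ1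
  set L := lcOf κ with hLdef
  have hL0 : 0 ≤ L := le_trans (by norm_num) hL
  have hL1 : 1 ≤ L := le_trans (by norm_num) hL
  have hr0 : 0 < r := by linarith
  have hr1 : (1 : ℝ) ≤ r := by linarith
  set Φ := phiOf Du r δ with hΦdef
  have hΦ0 : 0 ≤ Φ := by rw [hΦdef]; unfold phiOf; positivity
  obtain ⟨hχ0, hχS, hχabs, hχ1abs, hχone, hχfar, hχfin⟩ := chainCutoff_props hA hI hr0 SR hSR
  -- the scale
  have hσs0 : 0 < σs := by linarith
  have hρ64 : (64 : ℝ) ≤ σs ^ 2 := by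
    calc (64 : ℝ) = 8 * 8 := by norm_num
      _ ≤ σs * σs := mul_le_mul hσ8 hσ8 (by norm_num) hσs0.le
      _ = σs ^ 2 := by ring
  have hρr : 737600 * σs ^ 2 + 153600 ≤ r := hσs.le
  have hσr : σs ^ 2 ≤ r := by linarith [sq_nonneg σs]
  have hσ1 : (1 : ℝ) ≤ σs := by linarith
  -- the data of the relaxed datum
  have hj : ‖(![(0 : E3) + ξ₀, 0] : Fin 2 → E3) 0 - (![(0 : E3) + ξ₀, 0] : Fin 2 → E3) 1‖ = ‖ξ₀‖ := by
    simp only [Matrix.cons_val_zero, Matrix.cons_val_one, zero_add, sub_zero]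
  have hB0 : ‖(0 : E3 →L[ℝ] E3)‖ = 0 := norm_zero
  have hj0 : 0 ≤ ‖ξ₀‖ := norm_nonneg _
  have hξ100 : ‖ξ₀‖ ≤ 1 / 100 := hξja.trans hja
  have hΛ1 : lamOf Du ‖ξ₀‖ 0 ≤ 1 := by linarith
  have hΛ0 : 0 ≤ lamOf Du ‖ξ₀‖ 0 := by unfold lamOf; positivity
  -- the field of the relaxed datum: pointwise, masses, crude bound, global gradient
  have hvpt : ∀ x ∈ Sites₀ t A, ‖𝛘[r / 2, r / 4] x • ((π x - x) -
      (fun x : E3 => (0 : E3) + (if (∃ z ∈ Λ₀, x = t 0 + A z) then ξ₀ else 0)) x)‖ ≤ εp := by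
    intro x hxS
    rw [norm_smul, Real.norm_eq_abs]
    by_cases hxSR : x ∈ SR
    · calc _ ≤ 1 * εp := mul_le_mul (hχabs x) (hεp x hxSR) (norm_nonneg _) zero_le_one
        _ = εp := one_mul _
    · rw [hχ0 x hxS hxSR, abs_zero, zero_mul]; exact hεp0
  have hvD : ∀ x, ‖𝛘[r / 2, r / 4] x • ((π x - x) -
      (fun x : E3 => (0 : E3) + (if (∃ z ∈ Λ₀, x = t 0 + A z) then ξ₀ else 0)) x)‖ ≤ Du := by
    intro x
    by_cases hxS : x ∈ Sites₀ t A
    · exact (hvpt x hxS).trans hεpDu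
    · rw [norm_smul, Real.norm_eq_abs, hχS x hxS, abs_zero, zero_mul]; exact hDu0
  have hmass₀ : ∀ Y : ℝ, 1 ≤ Y →
      (∑' p : Sites₀ t A, ‖(fun x => 𝛘[r / 2, r / 4] x • ((π x - x) -
        (fun x : E3 => (0 : E3) + (if (∃ z ∈ Λ₀, x = t 0 + A z) then ξ₀ else 0)) x)) (p : E3)‖ ^ 2 * 𝟙ᵇ[p, c, Y]) ≤
        32 * Y ^ 3 * εp ^ 2 :=
    fun Y hY => mass_le_of_pointwise hA hI (c₀ := c)
      (fun x => 𝛘[r / 2, r / 4] x • ((π x - x) -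
        (fun x : E3 => (0 : E3) + (if (∃ z ∈ Λ₀, x = t 0 + A z) then ξ₀ else 0)) x)) hY fun x hx _ => hvpt x hx
  have hmassγ : ∀ Y : ℝ, 1 ≤ Y → σs ^ 2 ≤ Y → Y ≤ r / 4 →
      (∑' p : Sites₀ t A, ‖(fun x => 𝛘[r / 2, r / 4] x • ((π x - x) -
        (fun x : E3 => (0 : E3) + (if (∃ z ∈ Λ₀, x = t 0 + A z) then ξ₀ else 0)) x)) (p : E3)‖ ^ 2 * 𝟙ᵇ[p, c, Y]) ≤
        32 * γs ^ 2 * Y ^ 6 := by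
    intro Y h1 hlo _
    refine (hmass₀ Y h1).trans ?_
    have hY3 : σs ^ 6 ≤ Y ^ 3 := by
      have := pow_le_pow_left₀ (by positivity) hlo 3
      rwa [← pow_mul] at this
    have hY0 : 0 ≤ Y ^ 3 := by positivity
    have : εp ^ 2 ≤ γs ^ 2 * Y ^ 3 := by
      calc εp ^ 2 = γs ^ 2 * σs ^ 6 := by rw [← hγs]; ring
        _ ≤ γs ^ 2 * Y ^ 3 := mul_le_mul_of_nonneg_left hY3 (sq_nonneg _)
    have h32 := mul_le_mul_of_nonneg_left this (by positivity : (0 : ℝ) ≤ 32 * Y ^ 3)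
    have e : 32 * Y ^ 3 * (γs ^ 2 * Y ^ 3) = 32 * γs ^ 2 * Y ^ 6 := by ring
    linarith
  have hDu' : ∀ x ∈ SR, ‖(π x - x) - (fun x : E3 => (0 : E3) + (if (∃ z ∈ Λ₀, x = t 0 + A z) then ξ₀ else 0)) x‖ ≤ Du :=
    fun x hx => (hεp x hx).trans hεpDu
  have hja' : ‖(![(0 : E3) + ξ₀, 0] : Fin 2 → E3) 0 - (![(0 : E3) + ξ₀, 0] : Fin 2 → E3) 1‖ ≤ ja := by
    rw [hj]; exact hξja
  have hjb' : ‖(0 : E3 →L[ℝ] E3)‖ ≤ jb := by rw [hB0]; exact hjb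
  have hBr' : 2 * r * ‖(0 : E3 →L[ℝ] E3)‖ ≤ 1 / 100 := by rw [hB0, mul_zero]; norm_num
  have hr64 : (64 : ℝ) ≤ r := by linarith
  have hNNtot := fun Xr : ℝ =>
    (NN_total_le_gen (aff := fun x : E3 => (0 : E3) + (if (∃ z ∈ Λ₀, x = t 0 + A z) then ξ₀ else 0))
      (a := (![(0 : E3) + ξ₀, 0] : Fin 2 → E3)) (B := (0 : E3 →L[ℝ] E3)) (x₀ := c) hA hI hκ0 hκ hX hsep hequil hδ hδ1
      hε0 hε hr64 hXb hπ hinj SR hSR haff₀ hrel₀ hja' hja hjb' hBr' hDu0 hDu1 hDu' CΛ c Xr).trans hN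
  -- the thresholds
  have hsmall' : lcOf κ ^ 13 * (γs * σs + σs ^ 2 * Φ + Du / (σs * r ^ 2) + σs ^ 2 * ν) ≤ κ ^ 2 / 10 ^ 11 := by
    unfold sAgg at hsmall; exact hsmall
  have hΛκ' : 4000000 * lamOf Du ‖(![(0 : E3) + ξ₀, 0] : Fin 2 → E3) 0 - (![(0 : E3) + ξ₀, 0] : Fin 2 → E3) 1‖
      ‖(0 : E3 →L[ℝ] E3)‖ ≤ κ / 16 := by rw [hj, hB0]; exact hΛκ
  have hΛ1' : lamOf Du ‖(![(0 : E3) + ξ₀, 0] : Fin 2 → E3) 0 - (![(0 : E3) + ξ₀, 0] : Fin 2 → E3) 1‖ ‖(0 : E3 →L[ℝ] E3)‖ ≤ 1 := by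
    rw [hj, hB0]; exact hΛ1
  obtain ⟨hs₁, hs₂, hs₃⟩ := step_thresholds (δ := δ) (j := ‖(![(0 : E3) + ξ₀, 0] : Fin 2 → E3) 0 - (![(0 : E3) + ξ₀, 0] : Fin 2 → E3) 1‖)
    (b := ‖(0 : E3 →L[ℝ] E3)‖) hκ0 hκ1 hσ8 hσr hγs0 hr1 hδ hDu0 (norm_nonneg _) (norm_nonneg _) hΛ1' hν hsmall'
  -- the step
  have hξκ' : ‖(![(0 : E3) + ξ₀, 0] : Fin 2 → E3) 0 - (![(0 : E3) + ξ₀, 0] : Fin 2 → E3) 1‖ ≤ κ / (2 * 10 ^ 10) := by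
    rw [hj]; exact hξκ
  have hBκ' : ‖(0 : E3 →L[ℝ] E3)‖ ≤ κ / (2 * 10 ^ 10) := by rw [hB0]; positivity
  have hcc : dist c c ≤ r / 8 := by rw [dist_self]; positivity
  have hN0 : 0 ≤ ν ^ 2 * r ^ 7 := by positivity
  obtain ⟨z₀, aT, BT, ξ, w, hz₀, hp₀c, hBT, -, hjump, hval, hξ, haff', hrel', hwfin, hW, henv⟩ :=
    scale_step (aff := fun x : E3 => (0 : E3) + (if (∃ z ∈ Λ₀, x = t 0 + A z) then ξ₀ else 0))
      (a := (![(0 : E3) + ξ₀, 0] : Fin 2 → E3)) (B := (0 : E3 →L[ℝ] E3)) (c₀ := c)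
      hA hI hκ0 hκ1 hκ hX hsep hequil hδ hδ1 hε0 hε hr hXb hπ hinj SR hSR (𝛘[r / 2, r / 4]) hχ0 hχS
      hχabs hχ1abs hχone hχfar hχfin haff₀ hrel₀ hξκ' hBκ' hBr' hcc hρ64 hρr (sq_nonneg γs) hDu0 hDu1 hDu' hΛκ' hvD
      hN0 hNNtot hmassγ hs₁ hs₂ hs₃
  -- the increments in the root variables
  rw [hj, hB0] at hBT hjump hval hξ hW henv
  have hΘ₁ := sqrt_thetaOne_le (δ := δ) (ν := ν) hκ0 hκ1 hσ8 hσr hγs0 hr1 hδ hDu0 hj0 le_rfl hΛ1 hν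
  have hΘ₂ := sqrt_thetaTwo_le (δ := δ) (ν := ν) hκ0 hκ1 hσ8 hσr hγs0 hr1 hδ hDu0 hj0 le_rfl hΛ1 hν
  have hVsq := sqrt_vsq_le (δ := δ) hκ0 hκ1 hσ8 hσr hγs0 hr1 hδ hDu0 hj0 le_rfl hΛ1
  have hJp := jump_le_root (δ := δ) (ν := ν) hκ0 hκ1 hσ8 hσr hγs0 hr1 hδ hDu0 hj0 le_rfl hΛ1 hν
  have hXi := xi_le_root (δ := δ) (ν := ν) hκ0 hκ1 hσ8 hσr hγs0 hr1 hδ hDu0 hj0 le_rfl hΛ1 hν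
  set S : ℝ := γs * σs + σs ^ 2 * Φ + Du / (σs * r ^ 2) + σs ^ 2 * ν with hSdef
  set V : ℝ := γs * σs ^ 3 + σs ^ 4 * Φ + σs ^ 2 * Du / r ^ 2 with hVdef
  have hS0 : 0 ≤ S := by rw [hSdef]; positivity
  have hV0 : 0 ≤ V := by rw [hVdef]; positivity
  have eS : sAgg σs γs Φ Du r ν = S := by rw [hSdef]; unfold sAgg; rfl
  have eV : vAgg σs γs Φ Du r = V := by rw [hVdef]; unfold vAgg; rfl
  have hBTS : ‖BT‖ ≤ 12 * L ^ 8 * S := hBT.trans (by linarith)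
  have hjumpS : ‖aT 0 - aT 1‖ ≤ L ^ 11 * S := hjump.trans hJp
  have hξS : ‖ξ‖ ≤ L ^ 13 * S := hξ.trans hXi
  have hVa : ∀ m, ‖aT m‖ ≤ L ^ 8 * V + (66 / 5) * L ^ 8 * S := fun m => va_budget (hval m) hVsq hBTS
  have hVa0 : 0 ≤ L ^ 8 * V + (66 / 5) * L ^ 8 * S := by positivity
  have hK0 : 0 ≤ 1428 * Real.sqrt (thetaTwoOf κ (σs ^ 2) (γs ^ 2) r δ Du Du ‖ξ₀‖ 0 (ν ^ 2 * r ^ 7)) := by positivity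
  have hK : 1428 * Real.sqrt (thetaTwoOf κ (σs ^ 2) (γs ^ 2) r δ Du Du ‖ξ₀‖ 0 (ν ^ 2 * r ^ 7)) ≤
      1428 * L ^ 9 * (γs / σs + Φ + Du / (σs ^ 2 * r ^ 2) + σs ^ 2 * ν) := by
    have := mul_le_mul_of_nonneg_left hΘ₂ (by norm_num : (0 : ℝ) ≤ 1428); linarith
  have hW0 : 0 ≤ wsqOf κ (σs ^ 2) (γs ^ 2) r δ Du Du ‖ξ₀‖ 0 := by
    unfold wsqOf; have := ewOf_nonneg κ (σs ^ 2) (γs ^ 2) r δ Du Du ‖ξ₀‖ 0; positivity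
  have hWroot : wsqOf κ (σs ^ 2) (γs ^ 2) r δ Du Du ‖ξ₀‖ 0 ≤
      L ^ 12 * (γs + lamOf Du ‖ξ₀‖ 0 * γs * σs ^ 6 + σs ^ 7 * Φ + σs ^ 4 * Du / r ^ 2) ^ 2 := by
    have h := wsqOf_le (δ := δ) hκ0 hκ1 hρ64 hσr (sq_nonneg γs) hr1 hDu0 hj0 le_rfl hΛ1
    refine h.trans (mul_le_mul_of_nonneg_left ?_ (by positivity))
    have hx1 : 0 ≤ γs := hγs0
    have hx2 : 0 ≤ lamOf Du ‖ξ₀‖ 0 * γs * σs ^ 6 := by positivity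
    have hx3 : 0 ≤ σs ^ 7 * Φ := by positivity
    have hx4 : 0 ≤ σs ^ 4 * Du / r ^ 2 := by positivity
    have e1 : lamOf Du ‖ξ₀‖ 0 ^ 2 * γs ^ 2 * (σs ^ 2) ^ 6 = (lamOf Du ‖ξ₀‖ 0 * γs * σs ^ 6) ^ 2 := by ring
    have e2 : (σs ^ 2) ^ 7 * Φ ^ 2 = (σs ^ 7 * Φ) ^ 2 := by ring
    have e3 : (σs ^ 2) ^ 4 * Du ^ 2 / r ^ 4 = (σs ^ 4 * Du / r ^ 2) ^ 2 := by field_simp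
    rw [e1, e2, e3]
    exact sq_sum_ge hx1 hx2 hx3 hx4 le_rfl
  -- the new state
  refine ⟨fun x : E3 => (fun x : E3 => (0 : E3) + (if (∃ z ∈ Λ₀, x = t 0 + A z) then ξ₀ else 0)) x +
      ((if (∃ z ∈ Λ₀, x = t 1 + A z) then aT 1 else aT 0) + BT (x - (t 0 + A z₀))) +
      (if (∃ z ∈ Λ₀, x = t 0 + A z) then ξ else 0),
    (![(![(0 : E3) + ξ₀, 0] : Fin 2 → E3) 0 + aT 0 + BT (c - (t 0 + A z₀)) + ξ,
      (![(0 : E3) + ξ₀, 0] : Fin 2 → E3) 1 + aT 1 + BT (c - (t 0 + A z₀))] : Fin 2 → E3),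
    (0 : E3 →L[ℝ] E3) + BT,
    1428 * Real.sqrt (thetaTwoOf κ (σs ^ 2) (γs ^ 2) r δ Du Du ‖ξ₀‖ 0 (ν ^ 2 * r ^ 7)), ‖ξ‖,
    wsqOf κ (σs ^ 2) (γs ^ 2) r δ Du Du ‖ξ₀‖ 0, L ^ 8 * V + (66 / 5) * L ^ 8 * S, ‖BT‖,
    haff', hrel', hK0, hK, norm_nonneg _, ?_, hW0, hWroot, hVa0, ?_, norm_nonneg _, ?_, ?_, ?_, ?_, ?_, ?_, ?_⟩
  · rw [eS]; exact hξS
  · rw [eS, eV]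
  · rw [eS]; exact hBTS
  · -- fresh masses: the envelope
    intro Y h1 hY
    exact fresh_mass_le hA hI (c₀ := c)
      (fun x : E3 => 𝛘[r / 2, r / 4] x • ((π x - x) -
        ((fun x : E3 => (0 : E3) + (if (∃ z ∈ Λ₀, x = t 0 + A z) then ξ₀ else 0)) x +
          ((if (∃ z ∈ Λ₀, x = t 1 + A z) then aT 1 else aT 0) + BT (x - (t 0 + A z₀))) +
          (if (∃ z ∈ Λ₀, x = t 0 + A z) then ξ else 0))))
      w hwfin hK0 henv hW h1 hY
  · -- propagated masses: the triangle inequality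
    intro Y h1 hY
    have hp := propagated_mass_le hA hI (c₀ := c) (𝛘[r / 2, r / 4]) hχabs π
      (fun x : E3 => (0 : E3) + (if (∃ z ∈ Λ₀, x = t 0 + A z) then ξ₀ else 0)) aT BT ξ (t 0 + A z₀) hVa hp₀c h1 one_pos
    have e : (fun x : E3 => 𝛘[r / 2, r / 4] x • ((π x - x) -
        ((fun x : E3 => (0 : E3) + (if (∃ z ∈ Λ₀, x = t 0 + A z) then ξ₀ else 0)) x +
          (((if (∃ z ∈ Λ₀, x = t 1 + A z) then aT 1 else aT 0) + BT (x - (t 0 + A z₀))) +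
            (if (∃ z ∈ Λ₀, x = t 0 + A z) then ξ else 0))))) =
        (fun x : E3 => 𝛘[r / 2, r / 4] x • ((π x - x) -
          (fun x : E3 => (fun x : E3 => (0 : E3) + (if (∃ z ∈ Λ₀, x = t 0 + A z) then ξ₀ else 0)) x +
            ((if (∃ z ∈ Λ₀, x = t 1 + A z) then aT 1 else aT 0) + BT (x - (t 0 + A z₀))) +
            (if (∃ z ∈ Λ₀, x = t 0 + A z) then ξ else 0)) x)) := by
      funext x; simp only [add_assoc]
    rw [e] at hp
    refine hp.trans ?_
    have hold := hmass₀ Y h1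
    beta_reduce at hold ⊢
    linarith [hold]
  · exact (norm_add_le _ _).trans (by rw [hB0, zero_add])
  · have e : (![(![(0 : E3) + ξ₀, 0] : Fin 2 → E3) 0 + aT 0 + BT (c - (t 0 + A z₀)) + ξ,
        (![(0 : E3) + ξ₀, 0] : Fin 2 → E3) 1 + aT 1 + BT (c - (t 0 + A z₀))] : Fin 2 → E3) 0 -
        (![(![(0 : E3) + ξ₀, 0] : Fin 2 → E3) 0 + aT 0 + BT (c - (t 0 + A z₀)) + ξ,
          (![(0 : E3) + ξ₀, 0] : Fin 2 → E3) 1 + aT 1 + BT (c - (t 0 + A z₀))] : Fin 2 → E3) 1 =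
        ξ₀ + (aT 0 - aT 1) + ξ := by
      simp; abel
    rw [e, eS]
    have hL11 : L ^ 11 * S ≤ L ^ 13 * S := mul_le_mul_of_nonneg_right (pow_le_pow_right₀ hL1 (by norm_num)) hS0
    calc ‖ξ₀ + (aT 0 - aT 1) + ξ‖ ≤ ‖ξ₀‖ + ‖aT 0 - aT 1‖ + ‖ξ‖ := norm_add₃_le
      _ ≤ ‖ξ₀‖ + L ^ 11 * S + L ^ 13 * S := by linarith
      _ ≤ ‖ξ₀‖ + 2 * L ^ 13 * S := by linarith
  · -- the data
    have hBc : ‖BT (c - (t 0 + A z₀))‖ ≤ ‖BT‖ * (11 / 10) := by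
      refine (BT.le_opNorm _).trans (mul_le_mul_of_nonneg_left ?_ (norm_nonneg _))
      rw [← dist_eq_norm, dist_comm]; exact hp₀c
    intro m
    fin_cases m
    · simp only [Fin.zero_eta, Fin.isValue, Matrix.cons_val_zero, zero_add]
      calc ‖ξ₀ + aT 0 + BT (c - (t 0 + A z₀)) + ξ‖ ≤ ‖ξ₀‖ + ‖aT 0‖ + ‖BT (c - (t 0 + A z₀))‖ + ‖ξ‖ := by
            refine (norm_add_le _ _).trans (add_le_add ((norm_add_le _ _).trans (add_le_add (norm_add_le _ _) le_rfl)) le_rfl)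
        _ ≤ ‖ξ₀‖ + (L ^ 8 * V + (66 / 5) * L ^ 8 * S) + ‖BT‖ * (11 / 10) + ‖ξ‖ := by linarith [hVa 0, hBc]
    · simp only [Fin.mk_one, Fin.isValue, Matrix.cons_val_one, Matrix.cons_val_zero, zero_add]
      calc ‖aT 1 + BT (c - (t 0 + A z₀))‖ ≤ ‖aT 1‖ + ‖BT (c - (t 0 + A z₀))‖ := norm_add_le _ _
        _ ≤ ‖ξ₀‖ + (L ^ 8 * V + (66 / 5) * L ^ 8 * S) + ‖BT‖ * (11 / 10) + ‖ξ‖ := by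
            linarith [hVa 1, hBc, norm_nonneg ξ₀, norm_nonneg ξ]
  · -- displacement on the sites of B_r(c)
    intro x hx
    obtain ⟨hxS, hxc⟩ := (hSR x).1 hx
    have h1 := hεp x hx
    have hT : ‖(if (∃ z ∈ Λ₀, x = t 1 + A z) then aT 1 else aT 0) + BT (x - (t 0 + A z₀))‖ ≤
        (L ^ 8 * V + (66 / 5) * L ^ 8 * S) + ‖BT‖ * (r + 11 / 10) := by
      refine (norm_add_le _ _).trans (add_le_add ?_ ?_)
      · split_ifs
        · exact hVa 1
        · exact hVa 0
      · refine (BT.le_opNorm _).trans (mul_le_mul_of_nonneg_left ?_ (norm_nonneg _))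
        rw [← dist_eq_norm]
        have := dist_triangle x c (t 0 + A z₀)
        rw [dist_comm c (t 0 + A z₀)] at this
        linarith
    have hSξ : ‖(if (∃ z ∈ Λ₀, x = t 0 + A z) then ξ else 0)‖ ≤ ‖ξ‖ := by
      split_ifs
      · exact le_rfl
      · rw [norm_zero]; exact norm_nonneg _
    have e : (π x - x) - ((fun x : E3 => (0 : E3) + (if (∃ z ∈ Λ₀, x = t 0 + A z) then ξ₀ else 0)) x +
        ((if (∃ z ∈ Λ₀, x = t 1 + A z) then aT 1 else aT 0) + BT (x - (t 0 + A z₀))) +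
        (if (∃ z ∈ Λ₀, x = t 0 + A z) then ξ else 0)) =
        ((π x - x) - (fun x : E3 => (0 : E3) + (if (∃ z ∈ Λ₀, x = t 0 + A z) then ξ₀ else 0)) x) -
          (((if (∃ z ∈ Λ₀, x = t 1 + A z) then aT 1 else aT 0) + BT (x - (t 0 + A z₀))) +
            (if (∃ z ∈ Λ₀, x = t 0 + A z) then ξ else 0)) := by abel
    rw [e]
    refine (norm_sub_le _ _).trans ?_
    have h2 := (norm_add_le _ _).trans (add_le_add hT hSξ)
    linarith

end

end Summit.AtomisticToContinuum.Crystallization.Theorems.ExcessDecayLiouville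

end
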